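import Summits.QuantumFields.BalabanUV.Beta.GAN24.EffectiveFormInsertionLaw
import Literature.MathematicalPhysics.QuantumFieldTheory.Balaban1983to89.B6Constraint2153QvOp

/-!
# `BalabanUV.Beta.GAN24.EffectiveFormDelK` — binder row G-an2-4 ∕ (CONV-C), routes C-R6° («VALUES») × R7 («TWO CURRENCIES»), PART 176:
# THE LINEAGE's EFFECTIVE FORM IS THE β CELL's (1.65) OPERATOR — `(unitCovB_k)⁻¹ − a•1 = (Beta.BlockEffectiveAction.DelK n_k … M a) ∘ unitIdx` EXACTLY — hence, BY NAME:
# `Σ_k ⪰ 0` (census V198 (b) DISCHARGED), `Σ_k` Hermitian and `a`-free, and (2.153) FOR `Σ_k` — the k-UNIFORM coercivity `(1∕12d²)L^{−d−1}` on `ker Q̃ ∩ {axial}` — for every volume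
# of the form `M = fine L M′` (pv09's `B6Constraint2153QvOp.lower2153_DelK_of_QvOp`): the repaired model-side letter (d′) of census V199 is a TREE THEOREM under option (i)
# (unit b2b-balaban-gan24-p3, gen 59; v1.1 = v1 + §4, append-only)

NOT IN PRINT; OUR PROOF ([folklore] reindexing bookkeeping BY NAME over the β cell's `Beta.FluctuationProjection.QGQ` ∕ `QGQ_eq_smul` (`QGQ* = n^d•Q𝒢Qᴴ`), `Beta.BlockEffectiveAction.DelK` ∕
`DelK_eq` («(1.65) = (QGQ*)⁻¹ − a»), `DelK_posSemidef`, `DelK_indep`, `DelK_mulVec_grad`, pv09's `B6Constraint2153QvOp.lower2153_DelK_of_QvOp` ((2.153) for the genuine Δ_k under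
`QvOp L M′ · = 0` and the tree gauge, γ₀ = 1, constant `gamma2153one d L = (1∕12d²)L^{−(d+1)}`), the NE2 lineage's `BalabanAveragedTowerUnit.unitCovB` ∕ `avgTow` ∕
`BalabanAveragedCoerciveTower.Atow_QBlev_eq_submatrix` ∕ `unitIdx`, and Mathlib's `Matrix.inv_submatrix_equiv` ∕ `submatrix_one_equiv` ∕ `PosSemidef.submatrix`.
[Balaban1984PropagatorsI] (1.65) p. 29 and [Balaban1984PropagatorsII] (2.153) p. 249 LOCATE the objects; nothing printed is a hypothesis.)
HONEST FRAMING (cell contract, verbatim): «discharging `BetaPertH` makes Bałaban's UV stability UNCONDITIONAL — a real constructive-QFT result; it is NOT the continuum limit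
and NOT the Clay problem.»  HONEST DEPENDENCY (verbatim): «continuum YM on T⁴ ⇐ BetaPertH ∧ nine spine estimates (0/9 proved); BetaPertH ⇐ (D1) ∧ (D4) ∧ CAP+tail; G-an2-4 gates
asym, D1 and NE2/3/4.»

WHY (census V198 ∕ V199, gen 59).  PART 175 (`EffectiveFormKernel`) showed that the lineage's `Σ_k = (unitCovB L M a ha k)⁻¹ − a•1` annihilates every unit-lattice pure gauge, so the located
letter (d) «kernel coercivity on `ker Q̃`» is false and the repaired letter is Bałaban's (2.153): coercivity on `ker Q̃ ∩ {B axial}`.  THIS FILE observes that the repaired letter is ALREADY IN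
THE TREE: the β cell's (1.65) operator `DelK n hn M a ha = (QvOp·𝒢·QvAdj)⁻¹ − a•1` on `Tor M × Fin d` IS `Σ_k` at `n = L^k` read through the lineage's own relabelling `unitIdx : idx L M 0 ≃
Tor M × Fin d` (§1), so every β ∕ pv09 theorem about `DelK` is a theorem about `Σ_k` (§2), in particular pv09's kernel-checked (2.153) (§3) — with a constant `(1∕12d²)L^{−d−1}` that does NOT
depend on `k` — whenever the unit torus is written `M = fine L M′` (periods `L·M′_μ`: census V197's option (i) volumes; then `unitIdx` lands on pv09's carrier `Tor (fine L M′) × Fin d` with no cast).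

WHAT THIS FILE PROVES (0 sorry, 0 `def`; `L ≥ 1`, every torus `M`, `a > 0`, every `k`; §3 for `d ≥ 2` and `M = fine L M′`):
* §1 `ofReal_pow_pow_eq` (`((L^d : ℝ) : ℂ)^k = (n_k : ℂ)^d`), **`unitCovB_eq_QGQ_submatrix`** (`unitCovB_k = QGQ* ∘ unitIdx`), **`effForm_eq_DelK_submatrix`** (`Σ_k = Δ_k^{(1.65)} ∘ unitIdx`),
  `effForm_mulVec` (`Σ_k·v = (Δ_k·(v ∘ unitIdx⁻¹)) ∘ unitIdx`).
* §2 BY NAME from the β cell: **`effForm_posSemidef`** (`Σ_k ⪰ 0` — census V198 (b)), `effForm_isHermitian`, **`effForm_coercive_zero`** (`CoerciveInverseTower.Coercive 0 Σ_k`, the letter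
  PART 173 `psd_reM_of_coercive` consumes), `effForm_indep` (`Σ_k` does not depend on `a`), `effForm_mulVec_unitGrad_comp` (gauge invariance again, now one line from `DelK_mulVec_grad`).
* §3 **`lower2153_effForm`** — (2.153) FOR THE LINEAGE's `Σ_k`: for every REAL field `F` on `Tor (fine L M′) × Fin d` with `QvOp L M′ · F̃ = 0` (the next Bałaban averaging) and `F = 0` on the
  tree bonds of every `L`-block (pv09's `IsTree`), `(1∕12d²)L^{−d−1}·Σ_s F(s)² ≤ re⟨F̃ ∘ unitIdx, Σ_k (F̃ ∘ unitIdx)⟩` — k-UNIFORM; and `form_effForm_comp_unitIdx` (the form of `Σ_k` at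
  `v ∘ unitIdx` is the form of `Δ_k` at `v`); the constant is pv09's `gamma2153one_eq`: `(1∕(12d²))·L^{−(d+1)}`.
* §4 (v1.1, same gen) **`isReal_effForm`** (census V198 (a)), **`reDelK_eq_re_effForm`** (pv09's `reDelK (lev L k) … M` = `Re Σ_k` in box coordinates) and **`cov2156_effForm`**: the
  gauge-fixed fluctuation covariance `C(Cᵀ(Re Σ_k)C)⁻¹Cᵀ` of (2.156) decays, `|C^{(k)}(p,q)| ≤ c·e^{−δρ_M(p,q)}` with `c, δ` depending on `(d, L)` ONLY — every torus with `L ∣ M_i`,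
  EVERY `k` (`B6Cov2156TorusDelK.cov2156_torus_DelK` BY NAME): the (UD) half of the REPAIRED census-V195 letter.
WHAT IT IS NOT: the complex-vector upgrade of §3 (re ∕ im split for the IsReal Hermitian `Σ_k`) and the translation of pv09's box-coordinate tree condition into the lineage's `par ∕ rem`
vocabulary are left to the consumer; option (ii) volumes (one level down) are not treated; nothing here discharges the V195 letter itself (the gauge-fixed fluctuation covariance
`C(CᵀHC)⁻¹Cᵀ` of (2.154)–(2.157) is `B6Cov2156TorusDelK`'s object, to be wired by the adapter).  SUPPLIER work; NEVER «G-an2-4 closed»; NOT (CONV-C), NOT D1, NOT `BetaPertH`,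
NOT continuum, NOT Clay.  Records: `HOME/b2b-balaban-gan24-p3/gen59/README.md`.
-/

noncomputable section

open scoped BigOperators ComplexConjugate Matrix ComplexOrder
open Finset Matrix

namespace Summit.QuantumFields.BalabanUV.Beta.GAN24.EffectiveFormDelK

open Literature.MathematicalPhysics.QuantumFieldTheory.Balaban1983to89
open Literature.MathematicalPhysics.QuantumFieldTheory.Balaban1983to89.B5Prop11Plancherel (Tor fine)
open Literature.MathematicalPhysics.QuantumFieldTheory.Balaban1983to89.B5Prop11Lower (nsq)
open Literature.MathematicalPhysics.QuantumFieldTheory.Balaban1983to89.B5Action121 (GradOp)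
open Literature.MathematicalPhysics.QuantumFieldTheory.Balaban1983to89.B5Block118 (QvOp)
open Literature.MathematicalPhysics.QuantumFieldTheory.Balaban1983to89.B5Bounds167Lattice (ofRealCfg)
open Literature.MathematicalPhysics.QuantumFieldTheory.Balaban1983to89.B5G183RateUnitTower (lev)
open Literature.MathematicalPhysics.QuantumFieldTheory.Balaban1983to89.Beta.FluctuationProjection (QGQ QGQ_eq_smul)
open Literature.MathematicalPhysics.QuantumFieldTheory.Balaban1983to89.Beta.BlockEffectiveAction (DelK DelK_eq DelK_posSemidef DelK_indep DelK_mulVec_grad)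
open Literature.MathematicalPhysics.QuantumFieldTheory.Balaban1983to89.B6BondElimination (IsTree)
open Literature.MathematicalPhysics.QuantumFieldTheory.Balaban1983to89.B6Lemma24Torus (pbox coarseSites)
open Literature.MathematicalPhysics.QuantumFieldTheory.Balaban1983to89.B5RealFields (IsReal)
open Literature.MathematicalPhysics.QuantumFieldTheory.Balaban1983to89.B6BondEliminationTorus (pdist)
open Literature.MathematicalPhysics.QuantumFieldTheory.Balaban1983to89.B6Cov2156Torus (bondReductionT one_le_M)
open Literature.MathematicalPhysics.QuantumFieldTheory.Balaban1983to89.B6Cov2156TorusDelK (idxEquiv gamma2153one reDelK reDelK_apply isReal_DelK cov2156_torus_DelK)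
open Literature.MathematicalPhysics.QuantumFieldTheory.Balaban1983to89.B6Constraint2153QvOp (lower2153_DelK_of_QvOp)
open Summit.QuantumFields.BalabanUV.T4Continuum.CovariantAveragingTower (Atow avgTow)
open Summit.QuantumFields.BalabanUV.T4Continuum.CoerciveInverseTower (Coercive)
open Summit.QuantumFields.BalabanUV.T4Continuum.BalabanAveragedTowerUnit (idx QBlev calGlev unitCovB one_le_lev' cast_lev')
open Summit.QuantumFields.BalabanUV.T4Continuum.BalabanAveragedCoerciveTower (unitIdx Atow_QBlev_eq_submatrix)

/-! ## §1 The dictionary `Σ_k = Δ_k^{(1.65)} ∘ unitIdx` -/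

section Dictionary

variable {d : ℕ} (L : ℕ) [NeZero L] (M : Fin d → ℕ) [hM : ∀ μ, NeZero (M μ)] (a : ℝ) (ha : 0 < a)

omit [NeZero L] hM in
/-- `((L^d : ℝ) : ℂ)^k = (n_k : ℂ)^d`, `n_k = lev L k = L^k`. [folklore] -/
theorem ofReal_pow_pow_eq (k : ℕ) : ((((L : ℝ) ^ d : ℝ)) : ℂ) ^ k = (((lev L k : ℕ) : ℂ)) ^ d := by
  have h1 : (((lev L k : ℕ) : ℂ)) = (((lev L k : ℕ) : ℝ) : ℂ) := by norm_cast
  rw [h1, cast_lev']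
  push_cast
  rw [← pow_mul, ← pow_mul, mul_comm]

/-- **`unitCovB_eq_QGQ_submatrix`**: the lineage's `k`-step averaged covariance IS the β cell's `QGQ* = n^d•Q_k𝒢Q_kᴴ` at `n = L^k`, relabelled by `unitIdx`
(`Atow QBlev k = QvOp (lev L k) M ∘ unitIdx`, `calGlev k = calG (lev L k) …`). [folklore] -/
theorem unitCovB_eq_QGQ_submatrix (k : ℕ) :
    unitCovB L M a ha k = (QGQ (lev L k) (one_le_lev' L k) M a ha).submatrix (unitIdx L M) (unitIdx L M) := by
  rw [unitCovB, avgTow, ofReal_pow_pow_eq, QGQ_eq_smul, Matrix.submatrix_smul, Atow_QBlev_eq_submatrix]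
  congr 1

/-- **`effForm_eq_DelK_submatrix` — THE EFFECTIVE FORM IS THE (1.65) OPERATOR**: `(unitCovB_k)⁻¹ − a•1 = DelK (lev L k) … M a ha ∘ unitIdx` (`DelK = (QGQ*)⁻¹ − a•1`,
`Beta.BlockEffectiveAction.DelK_eq`; inverses and `1` commute with an `Equiv` relabelling). [cite: Balaban1984PropagatorsI, (1.65) p.29] [folklore] -/
theorem effForm_eq_DelK_submatrix (k : ℕ) :
    (unitCovB L M a ha k)⁻¹ - (a : ℂ) • (1 : Matrix (idx L M 0) (idx L M 0) ℂ)
      = (DelK (lev L k) (one_le_lev' L k) M a ha).submatrix (unitIdx L M) (unitIdx L M) := by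
  rw [unitCovB_eq_QGQ_submatrix, Matrix.inv_submatrix_equiv, DelK_eq]
  ext i j
  simp only [Matrix.submatrix_apply, Matrix.sub_apply, Matrix.smul_apply, Matrix.one_apply, (unitIdx L M).injective.eq_iff]

/-- `Σ_k·v = (Δ_k·(v ∘ unitIdx⁻¹)) ∘ unitIdx`. [folklore] -/
theorem effForm_mulVec (k : ℕ) (v : idx L M 0 → ℂ) :
    ((unitCovB L M a ha k)⁻¹ - (a : ℂ) • (1 : Matrix (idx L M 0) (idx L M 0) ℂ)) *ᵥ v
      = (DelK (lev L k) (one_le_lev' L k) M a ha *ᵥ (v ∘ (unitIdx L M).symm)) ∘ (unitIdx L M) := by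
  rw [effForm_eq_DelK_submatrix, Matrix.submatrix_mulVec_equiv]

/-- the form of `Σ_k` at `v ∘ unitIdx` is the form of `Δ_k` at `v`. [folklore] -/
theorem form_effForm_comp_unitIdx (k : ℕ) (v : Tor M × Fin d → ℂ) :
    star (v ∘ (unitIdx L M)) ⬝ᵥ (((unitCovB L M a ha k)⁻¹ - (a : ℂ) • (1 : Matrix (idx L M 0) (idx L M 0) ℂ)) *ᵥ (v ∘ (unitIdx L M)))
      = star v ⬝ᵥ (DelK (lev L k) (one_le_lev' L k) M a ha *ᵥ v) := by
  rw [effForm_mulVec]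
  have e : (v ∘ (unitIdx L M)) ∘ (unitIdx L M).symm = v := by
    funext j; simp only [Function.comp, Equiv.apply_symm_apply]
  rw [e]
  simp only [dotProduct, Function.comp, Pi.star_apply]
  exact Fintype.sum_equiv (unitIdx L M) _ _ fun i => rfl

end Dictionary

/-! ## §2 The β cell's letters for `Σ_k`, by name -/

section Letters

variable {d : ℕ} (L : ℕ) [NeZero L] (M : Fin d → ℕ) [hM : ∀ μ, NeZero (M μ)] (a : ℝ) (ha : 0 < a)

/-- **`effForm_posSemidef` — `Σ_k ⪰ 0`** (census V198 (b); `DelK_posSemidef`: `Δ_k = n^{−d}H_kᴴ(½ curlᴴcurl)H_k`). [cite: Balaban1984PropagatorsI, (1.65) p.29] [folklore] -/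
theorem effForm_posSemidef (k : ℕ) :
    ((unitCovB L M a ha k)⁻¹ - (a : ℂ) • (1 : Matrix (idx L M 0) (idx L M 0) ℂ)).PosSemidef := by
  rw [effForm_eq_DelK_submatrix]
  exact (DelK_posSemidef (lev L k) (one_le_lev' L k) M a ha).submatrix _

/-- `Σ_k` is Hermitian. [folklore] -/
theorem effForm_isHermitian (k : ℕ) :
    ((unitCovB L M a ha k)⁻¹ - (a : ℂ) • (1 : Matrix (idx L M 0) (idx L M 0) ℂ)).IsHermitian :=
  (effForm_posSemidef L M a ha k).isHermitian

/-- **`effForm_coercive_zero` — `CoerciveInverseTower.Coercive 0 Σ_k`** (the letter PART 173's `psd_reM_of_coercive` ∕ `abs_flucCov_le_QB_of_complexLetters` consume as `hpsdC`).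
[folklore] -/
theorem effForm_coercive_zero (k : ℕ) :
    Coercive 0 ((unitCovB L M a ha k)⁻¹ - (a : ℂ) • (1 : Matrix (idx L M 0) (idx L M 0) ℂ)) := by
  intro x
  rw [zero_mul]
  have h := (effForm_posSemidef L M a ha k).dotProduct_mulVec_nonneg x
  rw [Complex.le_def] at h
  simpa using h.1

/-- **`effForm_indep` — `Σ_k` does not depend on `a`** (`DelK_indep`: the `a`-term of `Δ_a` is subtracted back). [folklore] -/
theorem effForm_indep (k : ℕ) (a' : ℝ) (ha' : 0 < a') :
    (unitCovB L M a ha k)⁻¹ - (a : ℂ) • (1 : Matrix (idx L M 0) (idx L M 0) ℂ)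
      = (unitCovB L M a' ha' k)⁻¹ - (a' : ℂ) • (1 : Matrix (idx L M 0) (idx L M 0) ℂ) := by
  rw [effForm_eq_DelK_submatrix, effForm_eq_DelK_submatrix, DelK_indep]

/-- gauge invariance once more, now one line from the β cell's `DelK_mulVec_grad`: `Σ_k·((∂₁λ′) ∘ unitIdx) = 0` (PART 175 `effForm_mulVec_unitGrad` proved the same through the
tower's own letters). [folklore] -/
theorem effForm_mulVec_unitGrad_comp (k : ℕ) (lam' : Tor M → ℂ) :
    ((unitCovB L M a ha k)⁻¹ - (a : ℂ) • (1 : Matrix (idx L M 0) (idx L M 0) ℂ)) *ᵥ ((GradOp M 1 *ᵥ lam') ∘ (unitIdx L M)) = 0 := by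
  rw [effForm_mulVec]
  have e : ((GradOp M 1 *ᵥ lam') ∘ (unitIdx L M)) ∘ (unitIdx L M).symm = GradOp M 1 *ᵥ lam' := by
    funext j; simp only [Function.comp, Equiv.apply_symm_apply]
  rw [e, DelK_mulVec_grad]
  rfl

end Letters

/-! ## §3 (2.153) for `Σ_k` on `ker Q̃ ∩ {axial}`, k-uniformly — option (i) volumes `M = fine L M′` -/

section Lower

variable {d : ℕ} (L : ℕ) [NeZero L] (M' : Fin d → ℕ) [hM' : ∀ μ, NeZero (M' μ)] (a : ℝ) (ha : 0 < a)

/-- **`lower2153_effForm` — (2.153) FOR THE LINEAGE's EFFECTIVE FORM, k-UNIFORM**: on the unit torus of periods `L·M′` (the volumes of census V197's option (i)), for every level `k`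
and every REAL unit-lattice field `F` with `QvOp L M′·F̃ = 0` (the NEXT Bałaban averaging kills it) and `F = 0` on the tree bonds `Γ_{y,x}` of every `L`-block (axial gauge (2.121), pv09's
`IsTree`): `(1∕12d²)·L^{−d−1}·Σ_s F(s)² ≤ re⟨F̃ ∘ unitIdx, Σ_k·(F̃ ∘ unitIdx)⟩` — the constant does not depend on `k`, `a`, or the volume.  This is pv09's
`lower2153_DelK_of_QvOp` for `n = L^k` read through §1. [cite: Balaban1984PropagatorsII, (2.153) p.249; Balaban1984PropagatorsI, (1.65) p.29, (1.18) p.20] [folklore] -/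
theorem lower2153_effForm (hd : 2 ≤ d) (k : ℕ) (F : Tor (fine L M') × Fin d → ℝ)
    (hQ : QvOp L M' *ᵥ ofRealCfg (fine L M') F = 0)
    (hT : ∀ p : B4.Idx (pbox (fine L M')) d, IsTree L (coarseSites L (fine L M')) p → F (idxEquiv (fine L M') p) = 0) :
    gamma2153one d L * ∑ s, F s ^ 2
      ≤ (star (ofRealCfg (fine L M') F ∘ (unitIdx L (fine L M'))) ⬝ᵥ
          (((unitCovB L (fine L M') a ha k)⁻¹ - (a : ℂ) • (1 : Matrix (idx L (fine L M') 0) (idx L (fine L M') 0) ℂ)) *ᵥ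
            (ofRealCfg (fine L M') F ∘ (unitIdx L (fine L M'))))).re := by
  rw [form_effForm_comp_unitIdx]
  exact lower2153_DelK_of_QvOp L M' hd (lev L k) (one_le_lev' L k) a ha F hQ hT

end Lower

/-! ## §4 (v1.1) `Σ_k` is real; `Re Σ_k` in pv09's box coordinates IS `reDelK`; the gauge-fixed fluctuation covariance (2.156) of `Σ_k` decays, k-uniformly -/

section Junction

variable {d : ℕ} (L : ℕ) [NeZero L] (M : Fin d → ℕ) [hM : ∀ μ, NeZero (M μ)] (a : ℝ) (ha : 0 < a)

/-- **`isReal_effForm`** — `Σ_k` has real entries (census V198 (a); pv09's `isReal_DelK` through §1). [folklore] -/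
theorem isReal_effForm (k : ℕ) : IsReal ((unitCovB L M a ha k)⁻¹ - (a : ℂ) • (1 : Matrix (idx L M 0) (idx L M 0) ℂ)) := by
  rw [effForm_eq_DelK_submatrix]
  exact fun i j => isReal_DelK (lev L k) (one_le_lev' L k) M a ha _ _

/-- **`reDelK_eq_re_effForm`** — pv09's real box-coordinate matrix `reDelK (lev L k) … M` (the object of `B6Cov2156TorusDelK`: (2.152)–(2.157) end to end) IS `Re Σ_k` read through
`unitIdx⁻¹ ∘ idxEquiv`. [folklore] -/
theorem reDelK_eq_re_effForm (k : ℕ) (p q : B4.Idx (pbox M) d) :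
    reDelK (lev L k) (one_le_lev' L k) M p q
      = (((unitCovB L M a ha k)⁻¹ - (a : ℂ) • (1 : Matrix (idx L M 0) (idx L M 0) ℂ))
          ((unitIdx L M).symm (idxEquiv M p)) ((unitIdx L M).symm (idxEquiv M q))).re := by
  rw [reDelK_apply (lev L k) (one_le_lev' L k) M a ha, effForm_eq_DelK_submatrix, Matrix.submatrix_apply, Equiv.apply_symm_apply,
    Equiv.apply_symm_apply]

/-- **`cov2156_effForm` — THE REPAIRED ONE-LOOP LETTER's (UD) HALF, BY NAME, k-UNIFORM**: for `d ≥ 2` there are `c, δ > 0` depending on `(d, L)` ONLY such that on every unit torus with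
`L ∣ M_i`, at EVERY level `k`, the gauge-fixed fluctuation covariance `C^{(k)} = C(Cᵀ(Re Σ_k)C)⁻¹Cᵀ` of (2.156) (pv09's `bondReductionT L M (reDelK …)`, `C = elimT` the elimination operator of
{Q̃B = 0, B axial}) satisfies `|C^{(k)}(p, q)| ≤ c·e^{−δ·ρ_M(p, q)}` — `B6Cov2156TorusDelK.cov2156_torus_DelK` at `n = L^k`, with `reDelK = Re Σ_k` by `reDelK_eq_re_effForm`.  This is the
object that replaces an2's `flucCov(H, Q̃)` in census V195 (note `gen59/V198d-KERNEL.md` §C–§D). [cite: Balaban1984PropagatorsII, (2.152)-(2.157) pp.249-250] [folklore] -/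
theorem cov2156_effForm (hd : 2 ≤ d) (hL : 1 ≤ L) :
    ∃ c δ : ℝ, 0 < c ∧ 0 < δ ∧
      ∀ (M : Fin d → ℕ) [∀ μ, NeZero (M μ)], (∀ i, L ∣ M i) → ∀ (k : ℕ) (p q : B4.Idx (pbox M) d),
        |(bondReductionT L M (reDelK (lev L k) (one_le_lev' L k) M)).cov p q| ≤
          c * Real.exp (-(δ * pdist M (one_le_M M) (p.1 : Fin d → ℤ) (q.1 : Fin d → ℤ))) := by
  obtain ⟨c, δ, hc, hδ, H⟩ := cov2156_torus_DelK (L := L) d hd hL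
  exact ⟨c, δ, hc, hδ, fun M _ hLM k p q => H M hLM (lev L k) (one_le_lev' L k) p q⟩

end Junction

end Summit.QuantumFields.BalabanUV.Beta.GAN24.EffectiveFormDelK

end
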